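import Literature.MathematicalPhysics.StatisticalMechanics.CubicLatticeVoronoiFluctuations
import Literature.MeasureTheory.Integral.EuclideanDivergenceCoords
import Literature.Analysis.Convexity.AnisotropicPerimeterLowerSemicontinuity
import HarnessLib

/-!
# The anisotropic perimeter of a union of lattice cubes is at most its number of boundary faces
# (Cicalese–Leonardi 2020, (2.13) on `ℤ^d`: `F(ζ(X)) ≤ E_N(X)`), in every dimension

Topic `Literature/MathematicalPhysics/StatisticalMechanics`; continues `CubicLatticeVoronoiFluctuations.lean`
(bridge between the `ℤ^d` edge-isoperimetric vocabulary and Cicalese–Leonardi's continuum vocabulary) with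
the one analytic input of [CicaleseLeonardi2020] §3.1 that concerns the discrete side: for the
`ℓ¹`-anisotropic perimeter `F = P_1` (constraint body `[−1,1]^d`, density `‖ν‖₁`) and the Voronoi-cube
union `ζ(X) = V(X) = ⋃_{x∈X} x + [−½,½]^d` of a finite `X ⊂ ℤ^d`, "`F(ζ(X)) = E_N(X)`" (p. 6), where
`E_N(X) = Σ_x val(x, X)` is the number of boundary faces.  We prove the inequality `≤` — which is what the
quantitative-closeness condition (2.13) (`F(ζ(X)) ≤ E_N(X) + β_N`, `β_N = 0`) asks — for the tree's
DISTRIBUTIONAL anisotropic perimeter `anisotropicPerimeter K A = sup{∫_A div φ : φ ∈ C¹_c, φ(x) ∈ K}`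
(`Literature/Analysis/Convexity/AnisotropicPerimeter.lean`) and every constraint body
`K ⊆ {k : |k_i| ≤ 1 ∀ i}`, in every dimension `d = n + 1 ≥ 1`, via the divergence theorem on boxes.

## Contents (everything PROVED; no definition, no named fact is introduced)

* `setIntegral_fieldDivergence_box` — **the divergence theorem for a closed coordinate box of
  `EuclideanSpace ℝ (Fin (n+1))`** for the tree's `fieldDivergence` (Mathlib's
  `integral_divergence_of_hasFDerivAt_off_countable'` on `Fin (n+1) → ℝ`, transported along `toLp` with
  `Literature.MeasureTheory.Integral.setIntegral_fieldDivergence_eq_coords`); `abs_setIntegral_face_le`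
  (a face integral of a field with `|φ_i| ≤ 1` is at most the face area).
* `sum_sum_sub_le_card_boundaryPairs` — the combinatorial regrouping: for any face functional `T` with
  `|T| ≤ 1`, `Σ_{z∈C} Σ_i (T(z,i) − T(z−e_i,i)) ≤ #Θ_d(C)` (shared faces cancel; the rest are the boundary
  pairs, `card_boundaryPairs_eq_sum_card_filter`).
* Lattice cubes: `unitCubeAt_intVec_eq`, the half-open cubes (`halfOpenCube_subset`,
  `measurableSet_halfOpenCube`, `disjoint_halfOpenCube`), `volume_unitCubeAt_diff_halfOpenCube` (the top
  faces are null), `unitCubeAt_ae_eq_halfOpenCube`, `cubeUnion_image_intVec_ae_eq` (**`V(ι C)` is a.e. the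
  disjoint union of the half-open cubes**), `setIntegral_fieldDivergence_cubeUnion_eq_sum`,
  `setIntegral_fieldDivergence_unitCubeAt_intVec` (one cube in face form).
* `anisotropicPerimeter_cubeUnion_le` — **`P_K(V(ι C)) ≤ #Θ_d(C)` for `K ⊆ {k : |k_i| ≤ 1 ∀ i}`**.

WHAT IS NOT HERE: the reverse inequality `P_{[−1,1]^d}(V(ι C)) ≥ #Θ_d(C)` (equality in the source; it
needs explicit test fields and is not used by (2.13)); anything about non-cubic cells.

## References

* [CicaleseLeonardi2020] M. Cicalese, G. P. Leonardi, Comm. Math. Phys. 375 (2020) 1931–1944, §2.1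
  (2.13) p. 5 and §3.1 p. 6 (held text `paper:doi-10-1007-s00220-019-03612-3`, p0006: "We clearly have
  `|ζ(X)| = #(X)` and `F(ζ(X)) = E_N(X)` whenever `X ∈ 𝒳_N`").
* [Maggi2012] F. Maggi, *Sets of Finite Perimeter and Geometric Variational Problems*, (20.2) p. 258 (the
  distributional anisotropic perimeter).
* [EvansGariepy2015] L. C. Evans, R. F. Gariepy, *Measure Theory and Fine Properties of Functions*,
  Thm 5.16 (Gauss–Green), the box case being Mathlib's divergence theorem.
-/

noncomputable section

open Finset MeasureTheory
open scoped symmDiff ENNReal Pointwise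

namespace Literature.MathematicalPhysics.StatisticalMechanics

open Literature.Probability.LatticeModels
open Literature.Algebra.EuclideanLattices (intVec intVec_apply intVec_injective)
open Literature.MeasureTheory.Integral (fieldDivergence_eq_sum setIntegral_fieldDivergence_eq_coords
  continuous_apply_toLp continuous_fderiv_apply_toLp)
open Literature.Analysis.Convexity (anisotropicPerimeter continuous_fieldDivergence)

/-! ### H1: the divergence theorem for a coordinate box of `EuclideanSpace ℝ (Fin (n+1))` -/

/-- **Divergence theorem for a closed coordinate box of `ℝ^{n+1}`** (Mathlib's
`integral_divergence_of_hasFDerivAt_off_countable'` transported to `EuclideanSpace ℝ (Fin (n+1))` and the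
tree's `fieldDivergence`): `∫_{∏[a_i,b_i]} div φ = Σ_i (∫_{top face i} φ_i − ∫_{bottom face i} φ_i)`, the
faces parametrised by `Fin n → ℝ` through `Fin.insertNth`.
[cite: EvansGariepy2015, Thm 5.16 (Gauss–Green), box case — plumbing] -/
theorem setIntegral_fieldDivergence_box {n : ℕ}
    {φ : EuclideanSpace ℝ (Fin (n + 1)) → EuclideanSpace ℝ (Fin (n + 1))} (hφ : ContDiff ℝ 1 φ)
    {a b : Fin (n + 1) → ℝ} (hab : a ≤ b) :
    ∫ x in {x : EuclideanSpace ℝ (Fin (n + 1)) | ∀ i, a i ≤ x i ∧ x i ≤ b i}, fieldDivergence φ x =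
      ∑ i : Fin (n + 1),
        ((∫ y in Set.Icc (a ∘ i.succAbove) (b ∘ i.succAbove),
            (φ (WithLp.toLp 2 (i.insertNth (b i) y))) i) -
          ∫ y in Set.Icc (a ∘ i.succAbove) (b ∘ i.succAbove),
            (φ (WithLp.toLp 2 (i.insertNth (a i) y))) i) := by
  rw [setIntegral_fieldDivergence_eq_coords]
  have hpre : (WithLp.toLp 2) ⁻¹' {x : EuclideanSpace ℝ (Fin (n + 1)) | ∀ i, a i ≤ x i ∧ x i ≤ b i} =
      Set.Icc a b := by
    ext y
    simp only [Set.mem_preimage, Set.mem_setOf_eq, Set.mem_Icc, Pi.le_def]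
    exact ⟨fun h => ⟨fun i => (h i).1, fun i => (h i).2⟩, fun h i => ⟨h.1 i, h.2 i⟩⟩
  rw [hpre]
  -- the coordinate data for Mathlib's divergence theorem
  set L : (Fin (n + 1) → ℝ) →L[ℝ] EuclideanSpace ℝ (Fin (n + 1)) :=
    ((EuclideanSpace.equiv (Fin (n + 1)) ℝ).symm : (Fin (n + 1) → ℝ) →L[ℝ] EuclideanSpace ℝ (Fin (n + 1)))
    with hL
  have hLapp : ∀ y, L y = WithLp.toLp 2 y := fun y => rfl
  set f : Fin (n + 1) → (Fin (n + 1) → ℝ) → ℝ := fun i y => (φ (WithLp.toLp 2 y)) i with hf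
  set f' : Fin (n + 1) → (Fin (n + 1) → ℝ) → (Fin (n + 1) → ℝ) →L[ℝ] ℝ :=
    fun i y => (EuclideanSpace.proj i).comp ((fderiv ℝ φ (WithLp.toLp 2 y)).comp L) with hf'
  have hf'app : ∀ i y, f' i y (Pi.single i 1) =
      (fderiv ℝ φ (WithLp.toLp 2 y) (EuclideanSpace.single i 1)) i := fun i y => rfl
  have Hd : ∀ y ∈ (Set.univ.pi fun i => Set.Ioo (a i) (b i)) \ ∅, ∀ i, HasFDerivAt (f i) (f' i y) y := by
    intro y _ i
    have h1 : HasFDerivAt (⇑L) L y := L.hasFDerivAt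
    have h2 : HasFDerivAt φ (fderiv ℝ φ (WithLp.toLp 2 y)) (L y) :=
      (hφ.differentiable one_ne_zero _).hasFDerivAt
    have h3 := (EuclideanSpace.proj i : EuclideanSpace ℝ (Fin (n + 1)) →L[ℝ] ℝ).hasFDerivAt.comp y
      (h2.comp y h1)
    exact h3
  have Hc : ∀ i, ContinuousOn (f i) (Set.Icc a b) := fun i =>
    (continuous_apply_toLp hφ.continuous i).continuousOn
  have Hi : IntegrableOn (fun y => ∑ i, f' i y (Pi.single i 1)) (Set.Icc a b) := by
    refine Continuous.integrableOn_Icc (continuous_finsetSum _ fun i _ => ?_)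
    simp only [hf'app]
    exact continuous_fderiv_apply_toLp hφ i
  have key := integral_divergence_of_hasFDerivAt_off_countable' a b hab f f' ∅ Set.countable_empty Hc Hd Hi
  simp only [hf'app] at key
  exact key

/-- **A face integral of a `K`-valued field is at most the face area** when `K ⊆ {k : |k_i| ≤ 1 ∀ i}`:
`|∫_{∏_{j≠i}[a_j,b_j]} φ_i(insert_i c y) dy| ≤ ∏_{j≠i}(b_j − a_j)`.
[cite: Maggi2012, (20.2) p. 258 (admissible fields take values in `K`) — plumbing] -/
theorem abs_setIntegral_face_le {n : ℕ} {φ : EuclideanSpace ℝ (Fin (n + 1)) → EuclideanSpace ℝ (Fin (n + 1))}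
    (hφK : ∀ x i, |(φ x) i| ≤ 1) {a b : Fin (n + 1) → ℝ} (hab : a ≤ b) (i : Fin (n + 1)) (c : ℝ) :
    |∫ y in Set.Icc (a ∘ i.succAbove) (b ∘ i.succAbove), (φ (WithLp.toLp 2 (i.insertNth c y))) i| ≤
      ∏ j, (b (i.succAbove j) - a (i.succAbove j)) := by
  have hvol : volume (Set.Icc (a ∘ i.succAbove) (b ∘ i.succAbove)) =
      ENNReal.ofReal (∏ j, (b (i.succAbove j) - a (i.succAbove j))) := by
    rw [Real.volume_Icc_pi, ENNReal.ofReal_prod_of_nonneg fun j _ => ?_]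
    · rfl
    · exact sub_nonneg.2 (hab _)
  have h := norm_setIntegral_le_of_norm_le_const (hvol ▸ ENNReal.ofReal_lt_top)
    (fun y _ => hφK (WithLp.toLp 2 (i.insertNth c y)) i) (μ := volume)
    (f := fun y => (φ (WithLp.toLp 2 (i.insertNth c y))) i)
  rw [one_mul, Measure.real, hvol, ENNReal.toReal_ofReal
    (Finset.prod_nonneg fun j _ => sub_nonneg.2 (hab _))] at h
  rw [← Real.norm_eq_abs]
  exact h


/-! ### H2: regrouping the face terms of a union of lattice cubes into boundary pairs -/

variable {d : ℕ}

/-- `#Θ_d(C)` as a sum over the `2d` directions: `#(boundaryPairs C) = Σ_{(i,b)} #{x ∈ C : x ± e_i ∉ C}`.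
[cite: MaininiSchmidt2020, §1 (Θ_d); CicaleseLeonardi2020, §3 (3.16) p. 6] -/
theorem card_boundaryPairs_eq_sum_card_filter (C : Finset (Site d)) :
    #(boundaryPairs C) = ∑ p : Fin d × Bool, #(C.filter fun x => x + unitStep p.1 p.2 ∉ C) := by
  classical
  unfold boundaryPairs
  rw [card_filter, sum_product_right]
  refine Finset.sum_congr rfl fun p _ => ?_
  rw [card_filter]

/-- **Face terms regroup into boundary pairs.**  For any assignment `T z i` of a real number of modulus
`≤ 1` to each (top) face, `Σ_{z ∈ C} Σ_i (T(z,i) − T(z − e_i,i)) ≤ #Θ_d(C)`: faces shared by two cubes of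
`C` cancel, the remaining ones are in bijection with the boundary pairs.
[cite: CicaleseLeonardi2020, §3.1 p. 6 (`F(ζ(X)) = E_N(X)`)] -/
theorem sum_sum_sub_le_card_boundaryPairs (C : Finset (Site d)) (T : Site d → Fin d → ℝ)
    (hT : ∀ z i, |T z i| ≤ 1) :
    ∑ z ∈ C, ∑ i, (T z i - T (z - Pi.single i 1) i) ≤ #(boundaryPairs C) := by
  classical
  rw [sum_comm, card_boundaryPairs_eq_sum_card_filter, Nat.cast_sum, Fintype.sum_prod_type]
  refine Finset.sum_le_sum fun i _ => ?_
  rw [Fintype.sum_bool, sum_sub_distrib]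
  -- reindex the bottom faces
  have hinj : Function.Injective fun z : Site d => z - Pi.single i 1 := sub_left_injective
  have hre : ∑ z ∈ C, T (z - Pi.single i 1) i = ∑ w ∈ C.image (fun z => z - Pi.single i 1), T w i := by
    rw [sum_image fun x _ y _ h => hinj h]
  rw [hre, ← sum_sdiff_sub_sum_sdiff]
  -- identify the two difference sets
  have hA : C \ C.image (fun z => z - Pi.single i 1) = C.filter fun x => x + unitStep i true ∉ C := by
    ext z
    simp only [mem_sdiff, mem_image, mem_filter, unitStep, if_true, not_exists, not_and]
    constructor
    · rintro ⟨hz, h⟩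
      refine ⟨hz, fun h' => h _ h' ?_⟩
      simp
    · rintro ⟨hz, h⟩
      refine ⟨hz, fun w hw hwz => h ?_⟩
      have : w = z + Pi.single i 1 := by rw [← hwz]; simp
      rwa [this] at hw
  have hB : C.image (fun z => z - Pi.single i 1) \ C =
      (C.filter fun x => x + unitStep i false ∉ C).image fun z => z - Pi.single i 1 := by
    ext w
    simp only [mem_sdiff, mem_image, mem_filter, unitStep, Bool.false_eq_true, if_false, Pi.single_neg]
    constructor
    · rintro ⟨⟨z, hz, rfl⟩, hw⟩
      exact ⟨z, ⟨hz, by rwa [← sub_eq_add_neg]⟩, rfl⟩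
    · rintro ⟨z, ⟨hz, hzw⟩, rfl⟩
      exact ⟨⟨z, hz, rfl⟩, by rwa [← sub_eq_add_neg] at hzw⟩
  have h1 : ∑ z ∈ C \ C.image (fun z => z - Pi.single i 1), T z i ≤
      #(C.filter fun x => x + unitStep i true ∉ C) := by
    rw [hA]
    calc ∑ z ∈ C.filter (fun x => x + unitStep i true ∉ C), T z i
        ≤ ∑ z ∈ C.filter (fun x => x + unitStep i true ∉ C), (1 : ℝ) :=
          Finset.sum_le_sum fun z _ => (le_abs_self _).trans (hT z i)
      _ = _ := by simp
  have h2 : -(∑ w ∈ C.image (fun z => z - Pi.single i 1) \ C, T w i) ≤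
      #(C.filter fun x => x + unitStep i false ∉ C) := by
    rw [hB, sum_image fun x _ y _ h => hinj h, ← sum_neg_distrib]
    calc ∑ z ∈ C.filter (fun x => x + unitStep i false ∉ C), -T (z - Pi.single i 1) i
        ≤ ∑ z ∈ C.filter (fun x => x + unitStep i false ∉ C), (1 : ℝ) :=
          Finset.sum_le_sum fun z _ => (neg_le_abs _).trans (hT _ i)
      _ = _ := by simp
  linarith


/-! ### H3: lattice cubes — closed versus half-open, and the a.e.-disjoint decomposition of `V(ι C)` -/

/-- The closed Voronoi cube of a lattice point as a coordinate box with integer-shifted bounds.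
[cite: CicaleseLeonardi2020, §3.1 p. 6 (`ζ(X) = ⋃ x + [−½,½]^d`)] -/
theorem unitCubeAt_intVec_eq (z : Site d) :
    CicaleseLeonardi2020.unitCubeAt (intVec d z) =
      {x : EuclideanSpace ℝ (Fin d) | ∀ t, (z t : ℝ) - 1 / 2 ≤ x t ∧ x t ≤ (z t : ℝ) + 1 / 2} := by
  rw [CicaleseLeonardi2020.unitCubeAt_eq_setOf]; rfl

/-- The half-open lattice cube `∏_t [z_t − ½, z_t + ½)` is contained in the closed one.
[cite: CicaleseLeonardi2020, §3.1 p. 6 (`ζ(X)`)] -/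
theorem halfOpenCube_subset (z : Site d) :
    {x : EuclideanSpace ℝ (Fin d) | ∀ t, (z t : ℝ) - 1 / 2 ≤ x t ∧ x t < (z t : ℝ) + 1 / 2} ⊆
      CicaleseLeonardi2020.unitCubeAt (intVec d z) := by
  rw [unitCubeAt_intVec_eq]
  exact fun x hx t => ⟨(hx t).1, (hx t).2.le⟩

/-- The half-open lattice cubes are measurable. [cite: CicaleseLeonardi2020, §2 p. 4 (measurable sets `M`)] -/
theorem measurableSet_halfOpenCube (z : Site d) :
    MeasurableSet {x : EuclideanSpace ℝ (Fin d) | ∀ t, (z t : ℝ) - 1 / 2 ≤ x t ∧ x t < (z t : ℝ) + 1 / 2} := by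
  have e : {x : EuclideanSpace ℝ (Fin d) | ∀ t, (z t : ℝ) - 1 / 2 ≤ x t ∧ x t < (z t : ℝ) + 1 / 2} =
      ⋂ t, ({x : EuclideanSpace ℝ (Fin d) | (z t : ℝ) - 1 / 2 ≤ x t} ∩ {x | x t < (z t : ℝ) + 1 / 2}) := by
    ext x; simp
  rw [e]
  exact MeasurableSet.iInter fun t =>
    ((isClosed_le continuous_const (by fun_prop)).measurableSet.inter
      (isOpen_lt (by fun_prop) continuous_const).measurableSet)

/-- The closed lattice cube exceeds the half-open one by a null set (the top faces).
[cite: CicaleseLeonardi2020, §3.1 p. 6 (`|ζ(X)| = #X`)] -/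
theorem volume_unitCubeAt_diff_halfOpenCube (z : Site d) :
    volume (CicaleseLeonardi2020.unitCubeAt (intVec d z) \
      {x : EuclideanSpace ℝ (Fin d) | ∀ t, (z t : ℝ) - 1 / 2 ≤ x t ∧ x t < (z t : ℝ) + 1 / 2}) = 0 := by
  classical
  rw [unitCubeAt_intVec_eq]
  -- the difference lies in the union of the (degenerate) top faces
  have hsub : {x : EuclideanSpace ℝ (Fin d) | ∀ t, (z t : ℝ) - 1 / 2 ≤ x t ∧ x t ≤ (z t : ℝ) + 1 / 2} \
      {x : EuclideanSpace ℝ (Fin d) | ∀ t, (z t : ℝ) - 1 / 2 ≤ x t ∧ x t < (z t : ℝ) + 1 / 2} ⊆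
      ⋃ t : Fin d, {x : EuclideanSpace ℝ (Fin d) | ∀ s,
        Function.update (fun s => (z s : ℝ) - 1 / 2) t ((z t : ℝ) + 1 / 2) s ≤ x s ∧
          x s ≤ (z s : ℝ) + 1 / 2} := by
    intro x hx
    rw [Set.mem_sdiff, Set.mem_setOf_eq, Set.mem_setOf_eq, not_forall] at hx
    obtain ⟨h1, ⟨t, ht⟩⟩ := hx
    rw [Set.mem_iUnion]
    refine ⟨t, fun s => ⟨?_, (h1 s).2⟩⟩
    by_cases hs : s = t
    · subst hs
      rw [Function.update_self]
      have := (h1 s).1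
      exact le_of_not_gt fun h => ht ⟨this, h⟩
    · rw [Function.update_of_ne hs]; exact (h1 s).1
  refine measure_mono_null hsub ((measure_iUnion_null_iff).2 fun t => ?_)
  rw [volume_setOf_forall_le_and_le]
  exact Finset.prod_eq_zero (Finset.mem_univ t) (by rw [Function.update_self, sub_self, ENNReal.ofReal_zero])

/-- The closed and the half-open lattice cubes agree a.e. [cite: CicaleseLeonardi2020, §3.1 p. 6 (`|ζ(X)| = #X`)] -/
theorem unitCubeAt_ae_eq_halfOpenCube (z : Site d) :
    (CicaleseLeonardi2020.unitCubeAt (intVec d z) : Set (EuclideanSpace ℝ (Fin d))) =ᵐ[volume]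
      {x : EuclideanSpace ℝ (Fin d) | ∀ t, (z t : ℝ) - 1 / 2 ≤ x t ∧ x t < (z t : ℝ) + 1 / 2} := by
  rw [ae_eq_set]
  exact ⟨volume_unitCubeAt_diff_halfOpenCube z,
    by rw [Set.sdiff_eq_empty.2 (halfOpenCube_subset z), measure_empty]⟩

/-- Half-open lattice cubes of distinct lattice points are disjoint.
[cite: CicaleseLeonardi2020, §3.1 p. 6 (`|ζ(X)| = #X`)] -/
theorem disjoint_halfOpenCube {z w : Site d} (hzw : z ≠ w) :
    Disjoint {x : EuclideanSpace ℝ (Fin d) | ∀ t, (z t : ℝ) - 1 / 2 ≤ x t ∧ x t < (z t : ℝ) + 1 / 2}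
      {x : EuclideanSpace ℝ (Fin d) | ∀ t, (w t : ℝ) - 1 / 2 ≤ x t ∧ x t < (w t : ℝ) + 1 / 2} := by
  rw [Set.disjoint_left]
  intro x hx hx'
  apply hzw
  funext t
  obtain ⟨h1, h2⟩ := hx t
  obtain ⟨h3, h4⟩ := hx' t
  have h5 : ((z t : ℝ)) - (w t : ℝ) < 1 := by linarith
  have h6 : ((w t : ℝ)) - (z t : ℝ) < 1 := by linarith
  have h7 : z t - w t < 1 := by exact_mod_cast h5
  have h8 : w t - z t < 1 := by exact_mod_cast h6
  omega

/-- **`V(ι C)` is a.e. the disjoint union of the half-open lattice cubes of the points of `C`.**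
[cite: CicaleseLeonardi2020, §3.1 p. 6 (`ζ(X) = V(X)`, `|ζ(X)| = #X`)] -/
theorem cubeUnion_image_intVec_ae_eq (C : Finset (Site d)) :
    CicaleseLeonardi2020.cubeUnion (C.image (intVec d)) =ᵐ[volume]
      ⋃ z ∈ C, {x : EuclideanSpace ℝ (Fin d) | ∀ t, (z t : ℝ) - 1 / 2 ≤ x t ∧ x t < (z t : ℝ) + 1 / 2} := by
  classical
  have hV : CicaleseLeonardi2020.cubeUnion (C.image (intVec d)) =
      ⋃ z ∈ C, CicaleseLeonardi2020.unitCubeAt (intVec d z) := by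
    unfold CicaleseLeonardi2020.cubeUnion
    exact Finset.set_biUnion_finset_image
  rw [hV, ae_eq_set]
  constructor
  · refine measure_mono_null ?_ ((measure_biUnion_null_iff C.countable_toSet).2 fun z _ =>
      volume_unitCubeAt_diff_halfOpenCube z)
    intro x hx
    rw [Set.mem_sdiff, Set.mem_iUnion₂] at hx
    obtain ⟨⟨z, hz, hxz⟩, hno⟩ := hx
    rw [Set.mem_iUnion₂]
    refine ⟨z, hz, hxz, fun h => hno ?_⟩
    rw [Set.mem_iUnion₂]
    exact ⟨z, hz, h⟩
  · rw [Set.sdiff_eq_empty.2, measure_empty]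
    exact Set.iUnion₂_mono fun z _ => halfOpenCube_subset z

/-! ### H4: the divergence integral over `V(ι C)` and the voxel bound `P_K(V(ι C)) ≤ #Θ_d(C)` -/

/-- **The divergence integral over a union of lattice cubes splits into the cubes** (they are a.e.
disjoint): `∫_{V(ι C)} div φ = Σ_{z ∈ C} ∫_{cube z} div φ` for `φ ∈ C¹_c`.
[cite: CicaleseLeonardi2020, §3.1 p. 6 (`F(ζ(X)) = E_N(X)`); Maggi2012, (20.2) p. 258] -/
theorem setIntegral_fieldDivergence_cubeUnion_eq_sum (C : Finset (Site d))
    {φ : EuclideanSpace ℝ (Fin d) → EuclideanSpace ℝ (Fin d)} (hφ : ContDiff ℝ 1 φ)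
    (hφc : HasCompactSupport φ) :
    ∫ x in CicaleseLeonardi2020.cubeUnion (C.image (intVec d)), fieldDivergence φ x =
      ∑ z ∈ C, ∫ x in CicaleseLeonardi2020.unitCubeAt (intVec d z), fieldDivergence φ x := by
  classical
  have hint : Integrable (fieldDivergence φ) :=
    (continuous_fieldDivergence hφ).integrable_of_hasCompactSupport
      (Literature.Analysis.Convexity.hasCompactSupport_fieldDivergence' hφc)
  rw [setIntegral_congr_set (cubeUnion_image_intVec_ae_eq C),
    integral_biUnion_finset C (fun z _ => measurableSet_halfOpenCube z)
      (fun z _ w _ hzw => disjoint_halfOpenCube hzw) (fun z _ => hint.integrableOn)]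
  exact Finset.sum_congr rfl fun z _ => setIntegral_congr_set (unitCubeAt_ae_eq_halfOpenCube z).symm

/-- **The divergence integral over one lattice cube** `z + [−½,½]^{n+1}` in face form:
`Σ_i (T(z, i) − T(z − e_i, i))` with `T(z,i) = ∫ φ_i` over the top face of the cube `z` in direction `i`
(the bottom face of `z` is the top face of `z − e_i`).
[cite: EvansGariepy2015, Thm 5.16 (Gauss–Green), box case; CicaleseLeonardi2020, §3.1 p. 6] -/
theorem setIntegral_fieldDivergence_unitCubeAt_intVec {n : ℕ}
    {φ : EuclideanSpace ℝ (Fin (n + 1)) → EuclideanSpace ℝ (Fin (n + 1))} (hφ : ContDiff ℝ 1 φ)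
    (z : Site (n + 1)) :
    ∫ x in CicaleseLeonardi2020.unitCubeAt (intVec (n + 1) z), fieldDivergence φ x =
      ∑ i : Fin (n + 1),
        ((∫ y in Set.Icc (fun j => (z (i.succAbove j) : ℝ) - 1 / 2) (fun j => (z (i.succAbove j) : ℝ) + 1 / 2),
            (φ (WithLp.toLp 2 (i.insertNth ((z i : ℝ) + 1 / 2) y))) i) -
          ∫ y in Set.Icc (fun j => ((z - Pi.single i 1 : Site (n + 1)) (i.succAbove j) : ℝ) - 1 / 2)
              (fun j => ((z - Pi.single i 1 : Site (n + 1)) (i.succAbove j) : ℝ) + 1 / 2),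
            (φ (WithLp.toLp 2 (i.insertNth (((z - Pi.single i 1 : Site (n + 1)) i : ℝ) + 1 / 2) y))) i) := by
  rw [unitCubeAt_intVec_eq,
    setIntegral_fieldDivergence_box hφ (a := fun j => (z j : ℝ) - 1 / 2) (b := fun j => (z j : ℝ) + 1 / 2)
      (fun j => by simp only; linarith)]
  refine Finset.sum_congr rfl fun i _ => ?_
  have e1 : ∀ j, ((z - Pi.single i 1 : Site (n + 1)) (i.succAbove j) : ℝ) = (z (i.succAbove j) : ℝ) :=
    fun j => by rw [Pi.sub_apply, Pi.single_eq_of_ne (Fin.succAbove_ne i j), sub_zero]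
  have e2 : (((z - Pi.single i 1 : Site (n + 1)) i : ℤ) : ℝ) + 1 / 2 = (z i : ℝ) - 1 / 2 := by
    rw [Pi.sub_apply, Pi.single_eq_same]; push_cast; ring
  simp only [e1, e2]
  rfl

/-- **The voxel bound: `P_K(V(ι C)) ≤ #Θ_d(C)`** for every constraint body `K` inside the cube
`{k : |k_i| ≤ 1 ∀ i}` (so `h_K(±e_i) ≤ 1`) and every finite `C ⊂ ℤ^{n+1}`: the anisotropic perimeter of a
union of lattice unit cubes is at most its number of boundary faces.  With `K = [−1,1]^{n+1}`
(`h_K(ν) = ‖ν‖₁`) this is the inequality `F(ζ(X)) ≤ E_N(X)` (Cicalese–Leonardi (2.13) with `β_N = 0`;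
the source states equality, "`F(ζ(X)) = E_N(X)` whenever `X ∈ 𝒳_N`", p. 6).
[cite: CicaleseLeonardi2020, §3.1 p. 6 (`F(ζ(X)) = E_N(X)`), (2.13) p. 5; Maggi2012, (20.2) p. 258] -/
theorem anisotropicPerimeter_cubeUnion_le {n : ℕ} {K : Set (EuclideanSpace ℝ (Fin (n + 1)))}
    (hK : K ⊆ {k | ∀ i, |k i| ≤ 1}) (C : Finset (Site (n + 1))) :
    anisotropicPerimeter K (CicaleseLeonardi2020.cubeUnion (C.image (intVec (n + 1)))) ≤
      (#(boundaryPairs C) : ℝ≥0∞) := by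
  classical
  rw [Literature.Analysis.Convexity.anisotropicPerimeter_le_iff]
  intro φ hφ hφc hφK
  have hφK' : ∀ x i, |(φ x) i| ≤ 1 := fun x i => hK (hφK x) i
  -- the face functional
  set T : Site (n + 1) → Fin (n + 1) → ℝ := fun z i =>
    ∫ y in Set.Icc (fun j => (z (i.succAbove j) : ℝ) - 1 / 2) (fun j => (z (i.succAbove j) : ℝ) + 1 / 2),
      (φ (WithLp.toLp 2 (i.insertNth ((z i : ℝ) + 1 / 2) y))) i with hT
  have hTle : ∀ z i, |T z i| ≤ 1 := by
    intro z i
    have h := abs_setIntegral_face_le hφK' (a := fun j => (z j : ℝ) - 1 / 2) (b := fun j => (z j : ℝ) + 1 / 2)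
      (fun j => by simp only; linarith) i ((z i : ℝ) + 1 / 2)
    simp only [show ∀ j : Fin n, (z (i.succAbove j) : ℝ) + 1 / 2 - ((z (i.succAbove j) : ℝ) - 1 / 2) = 1
      from fun j => by ring, Finset.prod_const_one] at h
    exact h
  have hsum : ∫ x in CicaleseLeonardi2020.cubeUnion (C.image (intVec (n + 1))), fieldDivergence φ x =
      ∑ z ∈ C, ∑ i, (T z i - T (z - Pi.single i 1) i) := by
    rw [setIntegral_fieldDivergence_cubeUnion_eq_sum C hφ hφc]
    exact Finset.sum_congr rfl fun z _ => setIntegral_fieldDivergence_unitCubeAt_intVec hφ z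
  rw [hsum, ← ENNReal.ofReal_natCast]
  exact ENNReal.ofReal_le_ofReal (sum_sum_sub_le_card_boundaryPairs C T hTle)

end Literature.MathematicalPhysics.StatisticalMechanics

end
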